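import Literature.NumberTheory.Sieve.MatomakiRadziwillProp1U3
import Literature.NumberTheory.Sieve.MatomakiRadziwillLemma3
import Literature.NumberTheory.Sieve.MatomakiRadziwillLemma14
import Literature.NumberTheory.Sieve.MatomakiRadziwillTheorem1
import Literature.NumberTheory.LFunctions.GranvilleSoundararajan2003Proofs
import Literature.NumberTheory.LFunctions.GranvilleSoundararajanLemma23
import Literature.NumberTheory.LFunctions.GranvilleSoundararajanLemma71
import HarnessLib

/-!
# Matomäki–Radziwiłł 2016, Proposition 1 — part (e): the conclusion (§8.4)

Topic `NumberTheory/Sieve`; seventh and last file of the assembly of `MatomakiRadziwill2016_prop1`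
(Proposition 1 of K. Matomäki, M. Radziwiłł, *Multiplicative functions in short intervals*, Ann. of
Math. 183 (2016), §8), after `…Prop1Partition` (a: the partition `[T₀, T] = ⋃ⱼ 𝒯ⱼ ∪ 𝒰` and the
reduction (23) by Lemma 12), `…Prop1E1` (b: §8.1, `E₁`), `…Prop1Ej` (c: §8.2, `E_j`, `j ≥ 2`),
`…Prop1U1`–`…Prop1U3` (d: §8.3, `∫_𝒰`).  Everything here is proved; there are no new definitions and no
new named facts.

§8.4 of the paper: "Collecting all the bounds and referring to (23) we get
`∫_{T₀}^{T} |F(1+it)|² dt ≪ (T/(X/Q₁) + 1)(log Q₁)^{1/3}/P₁^{1/6-η}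
  + (T/X + 1)(∑_{2 ≤ j ≤ J} 1/(j² P₁) + (log X)^{-1/48+o(1)}) ≪ (T/(X/Q₁) + 1)((log Q₁)^{1/3}/P₁^{1/6-η} + (log X)^{-1/50})`,
which is the desired bound."  Together with the two reductions at the start of the proof ("Since the
mean value theorem gives the bound `O(T/X + 1)`, we can assume `T ≤ X`"; and the case `H₁ < 2`, in which
the first error term exceeds `1/2` and the trivial bound suffices, cf. `…Prop1Ej`), this file proves

* `SieveIntervalSystem.two_log_factorial_le_loglogQ`, `SieveIntervalSystem.four_pow_J_le` — the growth of
  the interval system forced by condition (3) (`log Q_j ≥ 48 j² log Q_{j-1}`, so `log log Q_J ≥ 2 log J!`)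
  and the consequence `4^J ≤ e^{2e^{72}} (log X)^{1/200}` (the paper's "`2^J ≪ (log X)^{o(1)}`"), which
  turns the factor `4^J (log X)^{-1/40}` of `SieveIntervalSystem.integral_Uset_bound` into `(log X)^{-1/50}`;
* `SieveIntervalSystem.sq_mul_Q_pred_le_P` (`j² Q_{j-1} ≤ P_j`, from (3)), `SieveIntervalSystem.inv_P_one_le`,
  `SieveIntervalSystem.Q_one_div_Hpar_one_ge_one` — the comparisons `1/P_j ≤ 1/(j² P₁) ≤ (1/j²)(1/H₁)`,
  `Q₁/H₁ ≥ 1` used in §8.4 and in the reduction to `T ≤ X`;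
* `MatomakiRadziwillProp1.eventually_size` — the size conditions `c2`–`c7` of `integral_Uset_bound` hold
  for all large `L = log X` (they are `o(1)`-statements: `log L = o(L^ε)`, `L^{99/100} = o(L)`);
* `MatomakiRadziwill2016_prop1_of_lemma3_lemma11` — **Proposition 1 from its two remaining named inputs**,
  Lemma 3 (`MatomakiRadziwill2016_lemma3`) and Lemma 11 (`MatomakiRadziwill2016_lemma11`); all other
  inputs (Lemmas 5, 6, 7, 8, 9, 12, 13, Brun–Titchmarsh, the upper-bound sieve) are proved in the tree;
* `MatomakiRadziwill2016_prop1_of_GS_ford_lemma11` — the same from Granville–Soundararajan's Theorem 1,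
  Ford's bound for `ζ` and Lemma 11, through `MatomakiRadziwill2016_lemma3_of_GS_ford`;
* the chain downstream (all reductions proved in the tree: `MatomakiRadziwill2016_theorem3_of_prop1_real` with
  the proved `MatomakiRadziwill2016_lemma14_real_holds`, `MatomakiRadziwill2016_theorem1_of_theorem3`,
  `matomaki_radziwill_of_theorem1`): `MatomakiRadziwill2016_theorem3_of_lemma3_lemma4_lemma11`,
  `MatomakiRadziwill2016_theorem1_of_lemma3_lemma4_lemma11`, `matomaki_radziwill_of_lemma3_lemma4_lemma11`
  — Theorem 3, Theorem 1 and parity.S38 `matomaki_radziwill` from the paper's Lemmas 3, 4 and 11 — and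
  `matomaki_radziwill_of_GS_ford_lemma11`, the same from the Granville–Soundararajan facts behind Lemmas 3
  and 4 (`MatomakiRadziwill2016_lemma4_of_GS`), Ford's bound and Lemma 11 — **`@[deprecated]` since the
  2026-08-15 verdict clean-up** (vacuous: its input `GranvilleSoundararajan2003_theorem4_sqrtRange`, GS03
  Theorem 4 for every maximiser, is refuted in tree, `GranvilleSoundararajan2003_theorem4_sqrtRange_false`;
  Lemma 4 is proved outright from the corrected central form, `MatomakiRadziwill2016_lemma4_holds` of
  `MatomakiRadziwillTheorem3VK.lean`, and parity.S38 follows as `matomaki_radziwill_of_lemma4_ford_khale`,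
  `matomaki_radziwill_of_khale`, `matomaki_radziwill_of_vk` there and in `MatomakiRadziwillTheorem1Khale.lean`).

Granville–Soundararajan's Theorem 1 is discharged in the tree (`GranvilleSoundararajan2003_theorem1_holds`,
`LFunctions/GranvilleSoundararajan2003Proofs.lean`), as are their Lemmas 2.3 and 7.1; plugging these in gives
`MatomakiRadziwill2016_prop1_of_ford_lemma11` and `matomaki_radziwill_of_GS_theorem3_theorem4_corollary3_ford_lemma11`
(the latter `@[deprecated]` with `matomaki_radziwill_of_GS_ford_lemma11`, for the same reason).
The discharge `MatomakiRadziwill2016_prop1_holds` therefore waits exactly on the named facts `zeta_bound_ford`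
(Ford 2002, Theorem 1; reduced in the tree to Ford's Theorem 2, `zeta_bound_ford_of_exp_sum_bound`) and
`MatomakiRadziwill2016_lemma11` (the Halász inequality for primes).

## References

* K. Matomäki, M. Radziwiłł, *Multiplicative functions in short intervals*, Ann. of Math. (2) 183
  (2016), 1015–1056, doi:10.4007/annals.2016.183.3.6, arXiv:1501.04585: §8 (arXiv pp. 16–18), in
  particular the first line of the proof ("we can assume `T ≤ X`"), display (23) and §8.4.
-/

noncomputable section

open Finset MeasureTheory Filter

namespace Literature.NumberTheory.Sieve

namespace SieveIntervalSystem

variable {η X : ℝ} (I : SieveIntervalSystem η X)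

/-! ### Growth of the interval system: `log log Q_J ≥ 2 log J!` and `4^J ≪ (log X)^{1/200}` -/

/-- Condition (3) forces `log Q_j ≥ log P_j ≥ (8 j²/η) log Q_{j-1} ≥ j² log Q_{j-1}`, hence by induction
`log log Q_j ≥ 2 log (j!)` for `j ≥ 1` (`log Q₁ > 1` by `one_lt_log_Q_one`).  This is the quantitative
content of the paper's remark "`2^J ≪ (log X)^{o(1)}`" (§8.3). [cite: MatomakiRadziwillAnnals2016, §8.3] -/
theorem two_log_factorial_le_loglogQ (hη : 0 < η) (hη6 : η < 1 / 6) {j : ℕ} (hj : 1 ≤ j) :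
    2 * Real.log (j.factorial : ℝ) ≤ Real.log (Real.log (I.Q j)) := by
  have hη' : η ≤ 8 := by linarith
  induction j, hj using Nat.le_induction with
  | base =>
    simp only [Nat.factorial_one, Nat.cast_one, Real.log_one, mul_zero]
    exact (Real.log_pos (I.one_lt_log_Q_one hη hη')).le
  | succ j hj ih =>
    have hQj : 1 < Real.log (I.Q j) := by
      rcases eq_or_lt_of_le hj with h | h
      · rw [← h]; exact I.one_lt_log_Q_one hη hη'
      · exact (I.one_lt_log_Q_one hη hη').trans_le
          (Real.log_le_log (I.pos_Q le_rfl) (I.Q_lt_Q hη hη' le_rfl h).le)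
    have hQj0 : 0 < Real.log (I.Q j) := by linarith
    have h3 := I.notTooClose (j + 1) (by omega)
    simp only [Nat.add_sub_cancel] at h3
    have hj1 : (1 : ℝ) ≤ ((j + 1 : ℕ) : ℝ) := by exact_mod_cast (by omega : 1 ≤ j + 1)
    have hj0 : (0 : ℝ) < ((j + 1 : ℕ) : ℝ) := by linarith
    have hlogj : 0 ≤ Real.log ((j + 1 : ℕ) : ℝ) := Real.log_nonneg hj1
    have hsq : (1 : ℝ) ≤ ((j + 1 : ℕ) : ℝ) ^ 2 := by nlinarith
    have hPpos : 0 < I.P (j + 1) := I.pos_P _ (by omega)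
    -- `log P_{j+1} ≥ ((j+1)²/η) · 8 log Q_j ≥ (j+1)² log Q_j`
    have hcoef : 0 < η / ((j + 1 : ℕ) : ℝ) ^ 2 := by positivity
    have hlogP : ((j + 1 : ℕ) : ℝ) ^ 2 * Real.log (I.Q j) ≤ Real.log (I.P (j + 1)) := by
      have h1 : 8 * Real.log (I.Q j) ≤ η / ((j + 1 : ℕ) : ℝ) ^ 2 * Real.log (I.P (j + 1)) := by
        linarith [mul_nonneg (by norm_num : (0 : ℝ) ≤ 16) hlogj]
      rw [div_mul_eq_mul_div, le_div_iff₀ (by positivity)] at h1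
      -- `8 log Q_j (j+1)² ≥ η (j+1)² log Q_j · 8 ≥ …`; use `η < 1/6 < 8`
      have h2 : ((j + 1 : ℕ) : ℝ) ^ 2 * Real.log (I.Q j) * η ≤ 8 * Real.log (I.Q j) * ((j + 1 : ℕ) : ℝ) ^ 2 := by
        have : 0 ≤ ((j + 1 : ℕ) : ℝ) ^ 2 * Real.log (I.Q j) := by positivity
        nlinarith
      have h3' : ((j + 1 : ℕ) : ℝ) ^ 2 * Real.log (I.Q j) * η ≤ η * Real.log (I.P (j + 1)) := h2.trans h1
      nlinarith
    have hlogQ : ((j + 1 : ℕ) : ℝ) ^ 2 * Real.log (I.Q j) ≤ Real.log (I.Q (j + 1)) :=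
      hlogP.trans (Real.log_le_log hPpos (I.P_le_Q _ (by omega)))
    have hprod : 0 < ((j + 1 : ℕ) : ℝ) ^ 2 * Real.log (I.Q j) := by positivity
    calc 2 * Real.log ((j + 1).factorial : ℝ)
        = 2 * Real.log ((j + 1 : ℕ) : ℝ) + 2 * Real.log (j.factorial : ℝ) := by
          rw [Nat.factorial_succ, Nat.cast_mul, Real.log_mul (by positivity) (by positivity)]
          ring
      _ ≤ 2 * Real.log ((j + 1 : ℕ) : ℝ) + Real.log (Real.log (I.Q j)) := by linarith
      _ = Real.log (((j + 1 : ℕ) : ℝ) ^ 2 * Real.log (I.Q j)) := by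
          rw [Real.log_mul (by positivity) hQj0.ne', Real.log_pow]; push_cast; ring
      _ ≤ Real.log (Real.log (I.Q (j + 1))) := Real.log_le_log hprod hlogQ

/-- **`4^J ≤ e^{2e^{72}} (log X)^{1/200}`** (for `log X ≥ 1`): from `Q_J ≤ exp(√log X)` one gets
`2 log J! ≤ log log Q_J ≤ ½ log log X`, and `log J! ≥ J log J - J` (`J^J/J! ≤ e^J`); so either
`log J ≥ 72`, when `J log 4 ≤ (71/50) J ≤ (1/50) log J! ≤ (1/200) log log X`, or `J < e^{72}`.
This is the paper's "`2^J ≪ (log X)^{o(1)}`" in the strength needed in §8.4.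
[cite: MatomakiRadziwillAnnals2016, §8.3] -/
theorem four_pow_J_le (hη : 0 < η) (hη6 : η < 1 / 6) (hL : 1 ≤ Real.log X) :
    (4 : ℝ) ^ I.J ≤ Real.exp (2 * Real.exp 72) * Real.log X ^ (1 / 200 : ℝ) := by
  have hη' : η ≤ 8 := by linarith
  have hL0 : 0 < Real.log X := by linarith
  have hJ1 : 1 ≤ I.J := I.one_le_J
  have hJpos : (0 : ℝ) < I.J := by exact_mod_cast hJ1
  -- `2 log J! ≤ log log Q_J ≤ (1/2) log log X`
  have hfac := I.two_log_factorial_le_loglogQ hη hη6 hJ1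
  have hQJ1 : 1 < Real.log (I.Q I.J) := by
    rcases eq_or_lt_of_le hJ1 with h | h
    · rw [← h]; exact I.one_lt_log_Q_one hη hη'
    · exact (I.one_lt_log_Q_one hη hη').trans_le
        (Real.log_le_log (I.pos_Q le_rfl) (I.Q_lt_Q hη hη' le_rfl h).le)
  have hlogQJ : Real.log (I.Q I.J) ≤ Real.sqrt (Real.log X) := by
    have := Real.log_le_log (I.pos_Q hJ1) I.Q_J_le
    rwa [Real.log_exp] at this
  have hll : Real.log (Real.log (I.Q I.J)) ≤ (1 / 2) * Real.log (Real.log X) := by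
    calc Real.log (Real.log (I.Q I.J)) ≤ Real.log (Real.sqrt (Real.log X)) :=
          Real.log_le_log (by linarith) hlogQJ
      _ = (1 / 2) * Real.log (Real.log X) := by
          rw [Real.sqrt_eq_rpow, Real.log_rpow hL0]
  -- `log J! ≥ J log J - J`
  have hstirling : (I.J : ℝ) * Real.log (I.J : ℝ) - I.J ≤ Real.log ((I.J).factorial : ℝ) := by
    have h := Real.pow_div_factorial_le_exp (I.J : ℝ) hJpos.le I.J
    have hfpos : (0 : ℝ) < ((I.J).factorial : ℝ) := by exact_mod_cast Nat.factorial_pos _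
    rw [div_le_iff₀ hfpos] at h
    have hpow : (0 : ℝ) < (I.J : ℝ) ^ I.J := by positivity
    have := Real.log_le_log hpow h
    rw [Real.log_pow, Real.log_mul (Real.exp_pos _).ne' hfpos.ne', Real.log_exp] at this
    linarith
  have hlog4 : Real.log 4 ≤ 71 / 50 := by
    have : Real.log 4 = 2 * Real.log 2 := by
      rw [show (4 : ℝ) = 2 ^ 2 by norm_num, Real.log_pow]; norm_num
    rw [this]
    have := Real.log_two_lt_d9
    linarith
  have hlog4' : 0 < Real.log 4 := Real.log_pos (by norm_num)
  have h4J : (4 : ℝ) ^ I.J = Real.exp (I.J * Real.log 4) := by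
    rw [← Real.rpow_natCast, Real.rpow_def_of_pos (by norm_num), mul_comm]
  have hrpow : Real.log X ^ (1 / 200 : ℝ) = Real.exp ((1 / 200) * Real.log (Real.log X)) := by
    rw [Real.rpow_def_of_pos hL0, mul_comm]
  have hrpow1 : 1 ≤ Real.log X ^ (1 / 200 : ℝ) := Real.one_le_rpow hL (by norm_num)
  by_cases hbig : 72 ≤ Real.log (I.J : ℝ)
  · -- `J log 4 ≤ (71/50) J ≤ (1/50) log J! ≤ (1/200) log log X`
    have h1 : (I.J : ℝ) * Real.log 4 ≤ (1 / 200) * Real.log (Real.log X) := by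
      have h71 : 71 * (I.J : ℝ) ≤ (I.J : ℝ) * Real.log (I.J : ℝ) - I.J := by nlinarith
      calc (I.J : ℝ) * Real.log 4 ≤ (I.J : ℝ) * (71 / 50) := mul_le_mul_of_nonneg_left hlog4 hJpos.le
        _ ≤ (1 / 50) * Real.log ((I.J).factorial : ℝ) := by linarith
        _ ≤ (1 / 200) * Real.log (Real.log X) := by linarith
    calc (4 : ℝ) ^ I.J = Real.exp (I.J * Real.log 4) := h4J
      _ ≤ Real.exp ((1 / 200) * Real.log (Real.log X)) := Real.exp_le_exp.2 h1
      _ = Real.log X ^ (1 / 200 : ℝ) := hrpow.symm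
      _ ≤ Real.exp (2 * Real.exp 72) * Real.log X ^ (1 / 200 : ℝ) :=
          le_mul_of_one_le_left (by positivity) (Real.one_le_exp (by positivity))
  · -- `J < e^{72}`
    push Not at hbig
    have hJlt : (I.J : ℝ) < Real.exp 72 := by
      rw [← Real.exp_log hJpos]; exact Real.exp_lt_exp.2 hbig
    have h1 : (I.J : ℝ) * Real.log 4 ≤ 2 * Real.exp 72 := by nlinarith
    calc (4 : ℝ) ^ I.J = Real.exp (I.J * Real.log 4) := h4J
      _ ≤ Real.exp (2 * Real.exp 72) := Real.exp_le_exp.2 h1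
      _ ≤ Real.exp (2 * Real.exp 72) * Real.log X ^ (1 / 200 : ℝ) :=
          le_mul_of_one_le_right (by positivity) hrpow1

/-! ### Comparisons between the error terms -/

/-- `j² Q_{j-1} ≤ P_j` for `j ≥ 2`: by (3), `log P_j ≥ (j²/η)(8 log Q_{j-1} + 16 log j) ≥ log Q_{j-1} + 2 log j`
(the paper: "since `P_j ≥ P_1^{j²}` by (3)", used as `∑_j 1/P_j ≪ 1/P₁`). [cite: MatomakiRadziwillAnnals2016, §8] -/
theorem sq_mul_Q_pred_le_P (hη : 0 < η) (hη6 : η < 1 / 6) {j : ℕ} (hj : 2 ≤ j) :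
    (j : ℝ) ^ 2 * I.Q (j - 1) ≤ I.P j := by
  have hη' : η ≤ 8 := by linarith
  have hj1 : 1 ≤ j - 1 := by omega
  have h3 := I.notTooClose j hj
  have hQpos : 0 < I.Q (j - 1) := I.pos_Q hj1
  have hQ1 : 1 ≤ I.Q (j - 1) := I.one_le_Q hη hη' hj1
  have hlogQ : 0 ≤ Real.log (I.Q (j - 1)) := Real.log_nonneg hQ1
  have hjR : (2 : ℝ) ≤ j := by exact_mod_cast hj
  have hjpos : (0 : ℝ) < j := by linarith
  have hlogj : 0 ≤ Real.log (j : ℝ) := Real.log_nonneg (by linarith)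
  have hPpos : 0 < I.P j := I.pos_P j (by omega)
  -- `η/j² ≤ 1/6 /4 ≤ 1`, so `log Q_{j-1} + 2 log j ≤ 8 log Q_{j-1} + 16 log j ≤ (η/j²) log P_j ≤ log P_j`
  have hcoefpos : 0 < η / (j : ℝ) ^ 2 := by positivity
  have hcoef : η / (j : ℝ) ^ 2 ≤ 1 := by
    rw [div_le_one (by positivity)]; nlinarith
  have hlogP0 : 0 ≤ Real.log (I.P j) := by
    by_contra hneg
    push Not at hneg
    have : η / (j : ℝ) ^ 2 * Real.log (I.P j) < 0 := mul_neg_of_pos_of_neg hcoefpos hneg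
    nlinarith
  have hkey : Real.log (I.Q (j - 1)) + 2 * Real.log (j : ℝ) ≤ Real.log (I.P j) := by
    calc Real.log (I.Q (j - 1)) + 2 * Real.log (j : ℝ)
        ≤ 8 * Real.log (I.Q (j - 1)) + 16 * Real.log (j : ℝ) := by nlinarith
      _ ≤ η / (j : ℝ) ^ 2 * Real.log (I.P j) := h3
      _ ≤ 1 * Real.log (I.P j) := mul_le_mul_of_nonneg_right hcoef hlogP0
      _ = Real.log (I.P j) := one_mul _
  have hlhs : Real.log ((j : ℝ) ^ 2 * I.Q (j - 1)) = Real.log (I.Q (j - 1)) + 2 * Real.log (j : ℝ) := by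
    rw [Real.log_mul (by positivity) hQpos.ne', Real.log_pow]; push_cast; ring
  rw [← hlhs] at hkey
  exact (Real.log_le_log_iff (by positivity) hPpos).1 hkey

/-- `1/P₁ ≤ 1/H₁ = (log Q₁)^{1/3}/P₁^{1/6-η}` (`P₁ ≥ 1`, `0 < 1/6 - η < 1`, `log Q₁ > 1`). [folklore] -/
theorem inv_P_one_le (hη : 0 < η) (hη6 : η < 1 / 6) : 1 / I.P 1 ≤ 1 / I.Hpar 1 := by
  have hη' : η ≤ 8 := by linarith
  rw [I.one_div_Hpar_one]
  have hP1 : 1 ≤ I.P 1 := I.one_le_P_one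
  have hP0 : 0 < I.P 1 := by linarith
  have hlogQ : 1 < Real.log (I.Q 1) := I.one_lt_log_Q_one hη hη'
  have h1 : 1 ≤ Real.log (I.Q 1) ^ (1 / 3 : ℝ) := Real.one_le_rpow hlogQ.le (by norm_num)
  have h2 : I.P 1 ^ (1 / 6 - η) ≤ I.P 1 := by
    conv_rhs => rw [← Real.rpow_one (I.P 1)]
    exact Real.rpow_le_rpow_of_exponent_le hP1 (by linarith)
  have h3 : 0 < I.P 1 ^ (1 / 6 - η) := Real.rpow_pos_of_pos hP0 _
  calc 1 / I.P 1 ≤ 1 / I.P 1 ^ (1 / 6 - η) := one_div_le_one_div_of_le h3 h2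
    _ ≤ Real.log (I.Q 1) ^ (1 / 3 : ℝ) / I.P 1 ^ (1 / 6 - η) :=
        div_le_div_of_nonneg_right h1 h3.le

/-- `Q₁ · (1/H₁) ≥ 1`: `1/H₁ = (log Q₁)^{1/3}/P₁^{1/6-η} ≥ 1/Q₁^{1/6-η} ≥ 1/Q₁` (this is why the trivial bound
`O(T/X + 1)` settles the case `T > X`: then `T/X ≤ (T Q₁/X)(1/H₁)`). [folklore] -/
theorem one_le_Q_one_div_Hpar_one (hη : 0 < η) (hη6 : η < 1 / 6) : 1 ≤ I.Q 1 * (1 / I.Hpar 1) := by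
  have hη' : η ≤ 8 := by linarith
  rw [I.one_div_Hpar_one]
  have hP1 : 1 ≤ I.P 1 := I.one_le_P_one
  have hP0 : 0 < I.P 1 := by linarith
  have hQ1 : 1 ≤ I.Q 1 := I.one_le_Q hη hη' le_rfl
  have hQ0 : 0 < I.Q 1 := by linarith
  have hlogQ : 1 < Real.log (I.Q 1) := I.one_lt_log_Q_one hη hη'
  have h1 : 1 ≤ Real.log (I.Q 1) ^ (1 / 3 : ℝ) := Real.one_le_rpow hlogQ.le (by norm_num)
  have h2 : I.P 1 ^ (1 / 6 - η) ≤ I.Q 1 := by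
    calc I.P 1 ^ (1 / 6 - η) ≤ I.Q 1 ^ (1 / 6 - η) :=
          Real.rpow_le_rpow hP0.le (I.P_le_Q 1 le_rfl) (by linarith)
      _ ≤ I.Q 1 ^ (1 : ℝ) := Real.rpow_le_rpow_of_exponent_le hQ1 (by linarith)
      _ = I.Q 1 := Real.rpow_one _
  have h3 : 0 < I.P 1 ^ (1 / 6 - η) := Real.rpow_pos_of_pos hP0 _
  rw [mul_div_assoc']
  rw [le_div_iff₀ h3, one_mul]
  calc I.P 1 ^ (1 / 6 - η) ≤ I.Q 1 := h2
    _ = I.Q 1 * 1 := (mul_one _).symm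
    _ ≤ I.Q 1 * Real.log (I.Q 1) ^ (1 / 3 : ℝ) := mul_le_mul_of_nonneg_left h1 hQ0.le

/-- `∑_{j=1}^{J} 1/j² ≤ 2`. [folklore] -/
theorem sum_Icc_inv_sq_le_two (J : ℕ) : ∑ j ∈ Icc 1 J, 1 / (j : ℝ) ^ 2 ≤ 2 := by
  have h := sum_Ioo_inv_sq_le (α := ℝ) 0 (J + 1)
  have hI : Icc 1 J = Ioo 0 (J + 1) := by
    ext j; simp [Nat.one_le_iff_ne_zero, Nat.pos_iff_ne_zero]
  rw [hI]
  simp only [one_div]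
  norm_num at h
  exact h

end SieveIntervalSystem

namespace MatomakiRadziwillProp1

/-! ### The size conditions on `L = log X` hold for all large `L` -/

/-- `log L ≤ c L^r` for all large `L` (`c, r > 0`), in the form used below. [folklore] -/
theorem eventually_log_le_rpow {c r : ℝ} (hc : 0 < c) (hr : 0 < r) :
    ∀ᶠ L : ℝ in atTop, Real.log L ≤ c * L ^ r := by
  filter_upwards [(isLittleO_log_rpow_atTop hr).bound hc, eventually_ge_atTop (1 : ℝ)] with L hL hL1
  rw [Real.norm_of_nonneg (Real.log_nonneg hL1),
    Real.norm_of_nonneg (Real.rpow_nonneg (by linarith) _)] at hL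
  exact hL

/-- **The size conditions of `SieveIntervalSystem.integral_Uset_bound` hold for all large `L = log X`**
(`c2`–`c7` there, together with `L ≥ 4`): each is an `o(1)` statement — `log L = o(L^ε)`,
`√L, L^{99/100} = o(L)` — made effective by `isLittleO_log_rpow_atTop` and `tendsto_rpow_atTop`; the
fourth condition is where `η > 0` enters ("`X > X(η)`"). [cite: MatomakiRadziwillAnnals2016, §8.3] -/
theorem eventually_size {η : ℝ} (hη : 0 < η) : ∀ᶠ L : ℝ in atTop,
    4 ≤ L ∧ 2 ≤ L ^ (1 / 50 : ℝ) ∧ 40 * L ^ (99 / 100 : ℝ) ≤ L ∧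
    L ^ (1 / 14 : ℝ) * Real.sqrt L *
        Real.exp (2 / 3 * Real.sqrt L + L ^ (99 / 100 : ℝ) - 2 * η * L) ≤ 1 ∧
    L * Real.exp (-(L ^ (1 / 100 : ℝ) / 6)) ≤ L ^ (1 / 50 - 1 / 16 : ℝ) ∧
    L ^ 202 * Real.exp (408 * L ^ (3 / 100 : ℝ) * Real.log L - L ^ (61 / 300 : ℝ) / 2) ≤ 1 ∧
    4 * L ≤ Real.exp (L ^ (97 / 100 : ℝ) / 2) := by
  -- c2
  have h2 : ∀ᶠ L : ℝ in atTop, 2 ≤ L ^ (1 / 50 : ℝ) :=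
    (tendsto_rpow_atTop (by norm_num)).eventually_ge_atTop 2
  -- c3
  have h3 : ∀ᶠ L : ℝ in atTop, 40 * L ^ (99 / 100 : ℝ) ≤ L := by
    filter_upwards [(tendsto_rpow_atTop (by norm_num : (0 : ℝ) < 1 / 100)).eventually_ge_atTop 40,
      eventually_gt_atTop (0 : ℝ)] with L hL hL0
    have hsplit : L = L ^ (99 / 100 : ℝ) * L ^ (1 / 100 : ℝ) := by
      rw [← Real.rpow_add hL0]; norm_num
    have h0 : 0 ≤ L ^ (99 / 100 : ℝ) := Real.rpow_nonneg hL0.le _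
    calc 40 * L ^ (99 / 100 : ℝ) = L ^ (99 / 100 : ℝ) * 40 := mul_comm _ _
      _ ≤ L ^ (99 / 100 : ℝ) * L ^ (1 / 100 : ℝ) := mul_le_mul_of_nonneg_left hL h0
      _ = L := hsplit.symm
  -- c4
  have h4 : ∀ᶠ L : ℝ in atTop, L ^ (1 / 14 : ℝ) * Real.sqrt L *
      Real.exp (2 / 3 * Real.sqrt L + L ^ (99 / 100 : ℝ) - 2 * η * L) ≤ 1 := by
    have hlog : ∀ᶠ L : ℝ in atTop, Real.log L ≤ η / 2 * L := by
      filter_upwards [Real.isLittleO_log_id_atTop.bound (show (0 : ℝ) < η / 2 by positivity),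
        eventually_ge_atTop (1 : ℝ)] with L hL hL1
      have hL' : |Real.log L| ≤ η / 2 * |L| := by simpa using hL
      rwa [abs_of_nonneg (Real.log_nonneg hL1), abs_of_nonneg (by linarith : (0 : ℝ) ≤ L)] at hL'
    have hsqrt : ∀ᶠ L : ℝ in atTop, Real.sqrt L ≤ η / 2 * L := by
      filter_upwards [eventually_ge_atTop (4 / η ^ 2), eventually_ge_atTop (0 : ℝ)] with L hL hL0
      have hs : 2 / η ≤ Real.sqrt L := by
        rw [show (2 : ℝ) / η = Real.sqrt ((2 / η) ^ 2) by rw [Real.sqrt_sq (by positivity)]]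
        exact Real.sqrt_le_sqrt (by rw [div_pow]; norm_num; linarith)
      have hsq : Real.sqrt L * Real.sqrt L = L := Real.mul_self_sqrt hL0
      have hs0 : 0 ≤ Real.sqrt L := Real.sqrt_nonneg L
      calc Real.sqrt L = η / 2 * (2 / η * Real.sqrt L) := by field_simp
        _ ≤ η / 2 * (Real.sqrt L * Real.sqrt L) :=
            mul_le_mul_of_nonneg_left (mul_le_mul_of_nonneg_right hs hs0) (by positivity)
        _ = η / 2 * L := by rw [hsq]
    have hpow : ∀ᶠ L : ℝ in atTop, L ^ (99 / 100 : ℝ) ≤ η / 2 * L := by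
      filter_upwards [(tendsto_rpow_atTop (by norm_num : (0 : ℝ) < 1 / 100)).eventually_ge_atTop (2 / η),
        eventually_gt_atTop (0 : ℝ)] with L hL hL0
      have hsplit : L = L ^ (99 / 100 : ℝ) * L ^ (1 / 100 : ℝ) := by
        rw [← Real.rpow_add hL0]; norm_num
      have h0 : 0 ≤ L ^ (99 / 100 : ℝ) := Real.rpow_nonneg hL0.le _
      calc L ^ (99 / 100 : ℝ) = η / 2 * (L ^ (99 / 100 : ℝ) * (2 / η)) := by field_simp
        _ ≤ η / 2 * (L ^ (99 / 100 : ℝ) * L ^ (1 / 100 : ℝ)) :=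
            mul_le_mul_of_nonneg_left (mul_le_mul_of_nonneg_left hL h0) (by positivity)
        _ = η / 2 * L := by rw [← hsplit]
    filter_upwards [hlog, hsqrt, hpow, eventually_gt_atTop (0 : ℝ)] with L hl hs hp hL0
    have hexp : L ^ (1 / 14 : ℝ) * Real.sqrt L *
        Real.exp (2 / 3 * Real.sqrt L + L ^ (99 / 100 : ℝ) - 2 * η * L) =
        Real.exp (1 / 14 * Real.log L + 1 / 2 * Real.log L +
          (2 / 3 * Real.sqrt L + L ^ (99 / 100 : ℝ) - 2 * η * L)) := by
      rw [Real.exp_add, Real.exp_add, Real.rpow_def_of_pos hL0, Real.sqrt_eq_rpow,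
        Real.rpow_def_of_pos hL0]
      ring_nf
    rw [hexp]
    refine Real.exp_le_one_iff.2 ?_
    nlinarith [mul_pos hη hL0]
  -- c5
  have h5 : ∀ᶠ L : ℝ in atTop, L * Real.exp (-(L ^ (1 / 100 : ℝ) / 6)) ≤ L ^ (1 / 50 - 1 / 16 : ℝ) := by
    filter_upwards [eventually_log_le_rpow (show (0 : ℝ) < 400 / 2502 by norm_num)
      (show (0 : ℝ) < 1 / 100 by norm_num), eventually_gt_atTop (0 : ℝ)] with L hL hL0
    have hlhs : L * Real.exp (-(L ^ (1 / 100 : ℝ) / 6)) =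
        Real.exp (Real.log L + -(L ^ (1 / 100 : ℝ) / 6)) := by
      rw [Real.exp_add, Real.exp_log hL0]
    have hrhs : L ^ (1 / 50 - 1 / 16 : ℝ) = Real.exp ((1 / 50 - 1 / 16) * Real.log L) := by
      rw [Real.rpow_def_of_pos hL0, mul_comm]
    rw [hlhs, hrhs]
    refine Real.exp_le_exp.2 ?_
    nlinarith
  -- c6
  have h6 : ∀ᶠ L : ℝ in atTop,
      L ^ 202 * Real.exp (408 * L ^ (3 / 100 : ℝ) * Real.log L - L ^ (61 / 300 : ℝ) / 2) ≤ 1 := by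
    filter_upwards [eventually_log_le_rpow (show (0 : ℝ) < 1 / 2448 by norm_num)
      (show (0 : ℝ) < 52 / 300 by norm_num), eventually_log_le_rpow (show (0 : ℝ) < 1 / 1212 by norm_num)
      (show (0 : ℝ) < 61 / 300 by norm_num), eventually_gt_atTop (0 : ℝ)] with L hA hB hL0
    have hpow : L ^ 202 = Real.exp (202 * Real.log L) := by
      rw [← Real.exp_log (pow_pos hL0 202), Real.log_pow]; norm_num
    have h61 : 0 ≤ L ^ (61 / 300 : ℝ) := Real.rpow_nonneg hL0.le _
    have hsplit : L ^ (3 / 100 : ℝ) * L ^ (52 / 300 : ℝ) = L ^ (61 / 300 : ℝ) := by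
      rw [← Real.rpow_add hL0]; norm_num
    have h03 : 0 ≤ L ^ (3 / 100 : ℝ) := Real.rpow_nonneg hL0.le _
    have hmid : 408 * L ^ (3 / 100 : ℝ) * Real.log L ≤ L ^ (61 / 300 : ℝ) / 6 := by
      calc 408 * L ^ (3 / 100 : ℝ) * Real.log L ≤ 408 * L ^ (3 / 100 : ℝ) * (1 / 2448 * L ^ (52 / 300 : ℝ)) :=
            mul_le_mul_of_nonneg_left hA (by positivity)
        _ = L ^ (61 / 300 : ℝ) / 6 := by rw [← hsplit]; ring
    rw [hpow, ← Real.exp_add]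
    refine Real.exp_le_one_iff.2 ?_
    linarith
  -- c7
  have h7 : ∀ᶠ L : ℝ in atTop, 4 * L ≤ Real.exp (L ^ (97 / 100 : ℝ) / 2) := by
    filter_upwards [eventually_log_le_rpow (show (0 : ℝ) < 1 / 4 by norm_num)
      (show (0 : ℝ) < 97 / 100 by norm_num),
      (tendsto_rpow_atTop (by norm_num : (0 : ℝ) < 97 / 100)).eventually_ge_atTop (4 * Real.log 4),
      eventually_gt_atTop (0 : ℝ)] with L hA hB hL0
    have h4L : 4 * L = Real.exp (Real.log 4 + Real.log L) := by
      rw [Real.exp_add, Real.exp_log (by norm_num), Real.exp_log hL0]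
    rw [h4L]
    refine Real.exp_le_exp.2 ?_
    linarith
  filter_upwards [eventually_ge_atTop (4 : ℝ), h2, h3, h4, h5, h6, h7] with L a b c d e f g
    using ⟨a, b, c, d, e, f, g⟩

end MatomakiRadziwillProp1

/-! ### Proposition 1 -/

set_option maxHeartbeats 1600000 in
/-- **Matomäki–Radziwiłł 2016, Proposition 1, from Lemma 3 and Lemma 11** (the conclusion §8.4 of the
printed proof, assembled from the files `…Prop1Partition`, `…Prop1E1`, `…Prop1Ej`, `…Prop1U1–U3`; Lemma 13
enters through `MatomakiRadziwill2016_lemma13_holds`, Lemmas 8♯ and 9 through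
`MatomakiRadziwillU.lemma8With_exists` / `lemma9With_exists`, Brun–Titchmarsh through `card_primes_Ioc_le`, the
sieve bound through `card_Icc_filter_forall_not_dvd_le`).  Given `η`, the constants of the inputs are fixed,
`X₀ = exp L₀` with `L₀` from `MatomakiRadziwillProp1.eventually_size`; then for `X ≥ X₀`, an interval system
`I` and `T ≥ T₀ = (log X)^{1/15}`:
* if `T > X`: the trivial bound `∫ ≤ 10 T/X + 72 ≤ 82 T/X` (`integral_trivial_le`) and `Q₁/H₁ ≥ 1`;
* if `H₁ < 2`: the trivial bound `≤ 82` and `1/H₁ > 1/2`;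
* otherwise, with `T' = max(T, X^{1/4}) ≤ X`: monotonicity in `T`, the reduction (23)
  (`integral_le_sum_Tset_add_Uset`), `E_one_le`, `E_j_le` with `1/(j² Q_{j-1}) ≤ (1/j²)(1/H₁)`,
  `1/H_j + 1/P_j ≤ (2/j²)(1/H₁)`, `∑ 1/j² ≤ 2`, and `integral_Uset_bound` with `4^J (log X)^{-1/40} ≤
  e^{2e^{72}} (log X)^{-1/50}` (`four_pow_J_le`); finally `T' Q₁/X + 1 ≤ 2 (T Q₁/X + 1)` as `X^{1/4} Q₁ ≤ X`.
[cite: MatomakiRadziwillAnnals2016, Proposition 1 (§8.4)] -/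
theorem MatomakiRadziwill2016_prop1_of_lemma3_lemma11 (h3 : MatomakiRadziwill2016_lemma3)
    (h11 : MatomakiRadziwill2016_lemma11) : MatomakiRadziwill2016_prop1 := by
  intro η hη hη6
  have hη' : η ≤ 8 := by linarith
  classical
  -- the constants of the inputs
  obtain ⟨C₁₃, h13⟩ := MatomakiRadziwill2016_lemma13_holds
  obtain ⟨C₃, hC₃, h3'⟩ := MatomakiRadziwillU.lemma3With_of h3
  obtain ⟨C₈, hC₈, h8⟩ := MatomakiRadziwillU.lemma8With_exists
  obtain ⟨C₉, hC₉, h9⟩ := MatomakiRadziwillU.lemma9With_exists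
  obtain ⟨C₁₁, hC₁₁, h11'⟩ := MatomakiRadziwillU.lemma11With_of h11
  obtain ⟨C, hC, hBT⟩ := card_primes_Ioc_le
  obtain ⟨K, hK0, hK⟩ := card_Icc_filter_forall_not_dvd_le
  -- the threshold `X₀ = exp L₀`
  obtain ⟨L₀, hL₀⟩ := Filter.eventually_atTop.1 (MatomakiRadziwillProp1.eventually_size hη)
  -- the constants of §8.4
  have hα : 0 < SieveIntervalSystem.alpha η 1 := by rw [SieveIntervalSystem.alpha_one]; linarith
  obtain ⟨K₁, hK₁⟩ : ∃ K₁ : ℝ, K₁ = 2880000 * (1 + 1 / (2 * SieveIntervalSystem.alpha η 1)) +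
      100000000 * max C₁₃ 0 + 40000 := ⟨_, rfl⟩
  obtain ⟨K₂, hK₂⟩ : ∃ K₂ : ℝ, K₂ = 20000 * (2 + K * (2 * Real.exp 6 + 1)) +
      160000 * C₉ * (4 + 4 ^ 20 * C₈) +
      17280000 * C₃ ^ 2 * C₁₁ * C * (1 + C₈) * Real.exp (2 * Real.exp 72) := ⟨_, rfl⟩
  have hK₁0 : 0 ≤ K₁ := by rw [hK₁]; positivity
  have hK₂0 : 0 ≤ K₂ := by rw [hK₂]; positivity
  refine ⟨164 + 4 * K₁ + 2 * K₂, Real.exp L₀, ?_⟩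
  intro f hf hf1 X hX I T hT
  -- sizes of `X`, `L = log X`, `T₀`, `T`
  have hX0 : 0 < X := (Real.exp_pos _).trans_le hX
  have hLL₀ : L₀ ≤ Real.log X := by
    have := Real.log_le_log (Real.exp_pos _) hX
    rwa [Real.log_exp] at this
  obtain ⟨hL4, c2, c3, c4, c5, c6, c7⟩ := hL₀ (Real.log X) hLL₀
  have hL1 : 1 ≤ Real.log X := by linarith
  have hL0 : 0 < Real.log X := by linarith
  have hXe : Real.exp 1 ≤ X := by
    rw [← Real.exp_log hX0]; exact Real.exp_le_exp.2 hL1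
  have hX1 : 1 ≤ X := le_trans (by have := Real.add_one_le_exp (1 : ℝ); linarith) hXe
  have hT₀1 : 1 ≤ Real.log X ^ (1 / 15 : ℝ) := Real.one_le_rpow hL1 (by norm_num)
  have hT₀0 : 0 ≤ Real.log X ^ (1 / 15 : ℝ) := by linarith
  have hT1 : 1 ≤ T := hT₀1.trans hT
  have hTpos : 0 < T := by linarith
  -- the interval system
  have hH0 : 0 < I.Hpar 1 := I.Hpar_one_pos hη hη'
  have hH0' : 0 < 1 / I.Hpar 1 := by positivity
  have hQ1 : 1 ≤ I.Q 1 := I.one_le_Q hη hη' le_rfl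
  have hQ0 : 0 < I.Q 1 := by linarith
  have hQX : I.Q 1 ≤ X := I.Q_one_le_X hη hη' hXe
  have hQH : 1 ≤ I.Q 1 * (1 / I.Hpar 1) := I.one_le_Q_one_div_Hpar_one hη hη6
  -- rewrite the target in terms of `R = T Q₁/X + 1` and `E = 1/H₁ + 1/L^{1/50}`
  rw [div_div_eq_mul_div, ← I.one_div_Hpar_one]
  have hLr0 : 0 < Real.log X ^ (1 / 50 : ℝ) := Real.rpow_pos_of_pos hL0 _
  have hE0 : 0 < 1 / I.Hpar 1 + 1 / Real.log X ^ (1 / 50 : ℝ) := by positivity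
  have hR1 : 1 ≤ T * I.Q 1 / X + 1 := by
    have : 0 ≤ T * I.Q 1 / X := by positivity
    linarith
  have hRE : T / X ≤ (T * I.Q 1 / X + 1) * (1 / I.Hpar 1 + 1 / Real.log X ^ (1 / 50 : ℝ)) := by
    have h1 : T / X ≤ T / X * (I.Q 1 * (1 / I.Hpar 1)) :=
      le_mul_of_one_le_right (by positivity) hQH
    have h2 : T / X * (I.Q 1 * (1 / I.Hpar 1)) = (T * I.Q 1 / X) * (1 / I.Hpar 1) := by ring
    have h3 : (T * I.Q 1 / X) * (1 / I.Hpar 1) ≤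
        (T * I.Q 1 / X + 1) * (1 / I.Hpar 1 + 1 / Real.log X ^ (1 / 50 : ℝ)) := by
      have ha : 0 ≤ T * I.Q 1 / X := by positivity
      have hb : 0 ≤ 1 / Real.log X ^ (1 / 50 : ℝ) := by positivity
      linarith [mul_nonneg ha hb, hH0'.le]
    linarith
  by_cases hTX : X < T
  · -- `T > X`: the trivial bound
    have htriv := I.integral_trivial_le f hf1 hX1 hT₀0 hT hTpos
    have h82 : 10 * T / X + 72 ≤ 82 * (T / X) := by
      have : 1 ≤ T / X := by rw [le_div_iff₀ hX0]; linarith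
      have h' : 10 * T / X = 10 * (T / X) := by ring
      linarith
    have hCbig : 82 * ((T * I.Q 1 / X + 1) * (1 / I.Hpar 1 + 1 / Real.log X ^ (1 / 50 : ℝ))) ≤
        (164 + 4 * K₁ + 2 * K₂) * (T * I.Q 1 / X + 1) * (1 / I.Hpar 1 + 1 / Real.log X ^ (1 / 50 : ℝ)) := by
      have hRE0 : 0 ≤ (T * I.Q 1 / X + 1) * (1 / I.Hpar 1 + 1 / Real.log X ^ (1 / 50 : ℝ)) := by positivity
      linarith [mul_nonneg hK₁0 hRE0, mul_nonneg hK₂0 hRE0]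
    linarith [mul_le_mul_of_nonneg_left hRE (by norm_num : (0 : ℝ) ≤ 82)]
  push Not at hTX
  by_cases hH1 : I.Hpar 1 < 2
  · -- `H₁ < 2`: the trivial bound again (`1/H₁ > 1/2`)
    have htriv := I.integral_trivial_le f hf1 hX1 hT₀0 hT hTpos
    have h82 : 10 * T / X + 72 ≤ 82 := by
      have : T / X ≤ 1 := by rw [div_le_one hX0]; exact hTX
      have h' : 10 * T / X = 10 * (T / X) := by ring
      linarith
    have hhalf : 1 / 2 ≤ 1 / I.Hpar 1 := one_div_le_one_div_of_le hH0 hH1.le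
    have hE : 1 / 2 ≤ (T * I.Q 1 / X + 1) * (1 / I.Hpar 1 + 1 / Real.log X ^ (1 / 50 : ℝ)) := by
      have hb : 0 ≤ 1 / Real.log X ^ (1 / 50 : ℝ) := by positivity
      have hprod := mul_nonneg (sub_nonneg.2 hR1) hE0.le
      linarith
    have hRE0 : 0 ≤ (T * I.Q 1 / X + 1) * (1 / I.Hpar 1 + 1 / Real.log X ^ (1 / 50 : ℝ)) := by positivity
    linarith [mul_nonneg hK₁0 hRE0, mul_nonneg hK₂0 hRE0]
  push Not at hH1
  -- the main case `T ≤ X`, `H₁ ≥ 2`; enlarge `T` to `T' = max(T, X^{1/4})`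
  set T' : ℝ := max T (X ^ (1 / 4 : ℝ)) with hT'
  have hTT' : T ≤ T' := le_max_left _ _
  have hXT' : X ^ (1 / 4 : ℝ) ≤ T' := le_max_right _ _
  have hX14 : X ^ (1 / 4 : ℝ) ≤ X := by
    conv_rhs => rw [← Real.rpow_one X]
    exact Real.rpow_le_rpow_of_exponent_le hX1 (by norm_num)
  have hT'X : T' ≤ X := max_le hTX hX14
  have hT'1 : 1 ≤ T' := hT1.trans hTT'
  have hT'0 : 0 ≤ T' := by linarith
  -- `R' = T' Q₁/X + 1 ≤ 2 R`
  obtain ⟨R', hR'⟩ : ∃ R' : ℝ, R' = T' * I.Q 1 / X + 1 := ⟨_, rfl⟩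
  have hR'1 : 1 ≤ R' := by
    have : 0 ≤ T' * I.Q 1 / X := by positivity
    linarith
  have hR'0 : 0 ≤ R' := by linarith
  have hTXR' : T' / X + 1 ≤ R' := by
    rw [hR']
    have : T' / X ≤ T' * I.Q 1 / X := by
      rw [mul_div_right_comm]
      exact le_mul_of_one_le_right (by positivity) hQ1
    linarith
  have hTXR'' : (T' + X) / X ≤ R' := by
    have : (T' + X) / X = T' / X + 1 := by field_simp
    rw [this]; exact hTXR'
  have hR'R : R' ≤ 2 * (T * I.Q 1 / X + 1) := by
    -- `X^{1/4} Q₁ ≤ X^{1/4} e^{√L} ≤ X` since `√L ≤ L/2 ≤ 3L/4` for `L ≥ 4`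
    have hsqrt : Real.sqrt (Real.log X) ≤ 3 / 4 * Real.log X := by
      have hs0 := Real.sqrt_nonneg (Real.log X)
      have hsq : Real.sqrt (Real.log X) * Real.sqrt (Real.log X) = Real.log X := Real.mul_self_sqrt hL0.le
      have hs2 : 2 ≤ Real.sqrt (Real.log X) := by nlinarith
      have := mul_nonneg hs0 (by linarith : 0 ≤ 3 / 4 * Real.sqrt (Real.log X) - 1)
      linarith
    have hXQ : X ^ (1 / 4 : ℝ) * I.Q 1 ≤ X := by
      calc X ^ (1 / 4 : ℝ) * I.Q 1 ≤ X ^ (1 / 4 : ℝ) * Real.exp (Real.sqrt (Real.log X)) :=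
            mul_le_mul_of_nonneg_left (I.Q_one_le hη hη') (Real.rpow_nonneg hX0.le _)
        _ = Real.exp (Real.log X * (1 / 4) + Real.sqrt (Real.log X)) := by
            rw [Real.exp_add, Real.rpow_def_of_pos hX0]
        _ ≤ Real.exp (Real.log X) := Real.exp_le_exp.2 (by linarith)
        _ = X := Real.exp_log hX0
    have hT'le : T' ≤ T + X ^ (1 / 4 : ℝ) := max_le (by linarith [Real.rpow_nonneg hX0.le (1 / 4 : ℝ)])
      (by linarith)
    have h1 : T' * I.Q 1 / X ≤ T * I.Q 1 / X + 1 := by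
      rw [div_le_iff₀ hX0, add_mul, div_mul_cancel₀ _ hX0.ne']
      linarith [mul_le_mul_of_nonneg_right hT'le hQ0.le]
    rw [hR']
    linarith [hR1]
  -- (i) monotonicity in `T`
  have hcont : Continuous fun t : ℝ => ‖∑ n ∈ (Icc ⌈X⌉₊ ⌊2 * X⌋₊).filter I.Mem,
      (f n : ℂ) * (n : ℂ) ^ (-(1 + (t : ℂ) * Complex.I))‖ ^ 2 :=
    ((MatomakiRadziwillLemma12.continuous_dsum _ _).norm).pow 2
  have hmono : ∫ t in Real.log X ^ (1 / 15 : ℝ)..T,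
        ‖∑ n ∈ (Icc ⌈X⌉₊ ⌊2 * X⌋₊).filter I.Mem, (f n : ℂ) * (n : ℂ) ^ (-(1 + (t : ℂ) * Complex.I))‖ ^ 2 ≤
      ∫ t in Real.log X ^ (1 / 15 : ℝ)..T',
        ‖∑ n ∈ (Icc ⌈X⌉₊ ⌊2 * X⌋₊).filter I.Mem, (f n : ℂ) * (n : ℂ) ^ (-(1 + (t : ℂ) * Complex.I))‖ ^ 2 :=
    intervalIntegral.integral_mono_interval le_rfl hT hTT'
      (Filter.Eventually.of_forall fun t => sq_nonneg _) (hcont.intervalIntegrable _ _)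
  -- (ii) the reduction (23)
  have hpart := I.integral_le_sum_Tset_add_Uset hη hη' f hf hf1 hX1 hT₀0 (hT.trans hTT') hT'1
    (fun j hj => le_trans (by linarith : (1 : ℝ) ≤ I.Hpar 1) (I.Hpar_one_le hη hη' (mem_Icc.1 hj).1))
  -- (iii) the `𝒯_j`-terms: `E_1`, `E_j` and the remainders of Lemma 12
  have hj_bound : ∀ j ∈ Icc 1 I.J,
      20000 * ((I.Hpar j * Real.log (I.Q j / I.P j)) *
          (∑ v ∈ I.blocks j, ∫ t in I.Tset (fun p => ((f p : ℝ) : ℂ)) (Real.log X ^ (1 / 15 : ℝ)) T' j,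
            ‖blockPrimePoly (fun p => ((f p : ℝ) : ℂ)) (I.P j) (I.Q j) (I.Hpar j) v t *
              blockCofactorPoly (I.bCoef f j) X (I.P j) (I.Q j) (I.Hpar j) v t‖ ^ 2)
        + (T' + X) / X * (1 / I.Hpar j + 1 / I.P j)) ≤
      K₁ * R' * (1 / I.Hpar 1) * (1 / (j : ℝ) ^ 2) := by
    intro j hj
    have hj1 : 1 ≤ j := (mem_Icc.1 hj).1
    have hjR : (1 : ℝ) ≤ j := by exact_mod_cast hj1
    have hjsq : 0 < (j : ℝ) ^ 2 := by positivity
    have hjsq' : 0 < 1 / (j : ℝ) ^ 2 := by positivity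
    -- `1/H_j = (1/j²)(1/H₁)` and `1/P_j ≤ (1/j²)(1/H₁)`
    have hHj : 1 / I.Hpar j = 1 / (j : ℝ) ^ 2 * (1 / I.Hpar 1) := by
      rw [I.Hpar_eq j, one_div_mul_one_div]
    have hPj : 1 / I.P j ≤ 1 / (j : ℝ) ^ 2 * (1 / I.Hpar 1) := by
      rcases eq_or_lt_of_le hj1 with h | h
      · rw [← h]; simpa using I.inv_P_one_le hη hη6
      · have hj2 : 2 ≤ j := h
        have hsq := I.sq_mul_Q_pred_le_P hη hη6 hj2
        have hQP : I.P 1 ≤ I.Q (j - 1) := I.P_one_le_Q_pred hη hη' hj2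
        have hP0 : 0 < I.P 1 := I.pos_P 1 le_rfl
        have hQpos : 0 < I.Q (j - 1) := I.pos_Q (by omega)
        calc 1 / I.P j ≤ 1 / ((j : ℝ) ^ 2 * I.Q (j - 1)) := one_div_le_one_div_of_le (by positivity) hsq
          _ ≤ 1 / ((j : ℝ) ^ 2 * I.P 1) :=
              one_div_le_one_div_of_le (by positivity) (mul_le_mul_of_nonneg_left hQP hjsq.le)
          _ = 1 / (j : ℝ) ^ 2 * (1 / I.P 1) := by rw [one_div_mul_one_div]
          _ ≤ 1 / (j : ℝ) ^ 2 * (1 / I.Hpar 1) :=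
              mul_le_mul_of_nonneg_left (I.inv_P_one_le hη hη6) hjsq'.le
    -- the remainder of Lemma 12
    have hB : 20000 * ((T' + X) / X * (1 / I.Hpar j + 1 / I.P j)) ≤
        40000 * R' * (1 / I.Hpar 1) * (1 / (j : ℝ) ^ 2) := by
      have h1 : 1 / I.Hpar j + 1 / I.P j ≤ 2 * (1 / (j : ℝ) ^ 2 * (1 / I.Hpar 1)) := by
        rw [hHj]; linarith
      have h0 : 0 ≤ 1 / I.Hpar j + 1 / I.P j := by
        have := I.pos_P j hj1
        have := (hH0.trans_le (I.Hpar_one_le hη hη' hj1))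
        positivity
      calc 20000 * ((T' + X) / X * (1 / I.Hpar j + 1 / I.P j))
          ≤ 20000 * (R' * (2 * (1 / (j : ℝ) ^ 2 * (1 / I.Hpar 1)))) := by
            gcongr 20000 * ?_
            exact mul_le_mul hTXR'' h1 h0 hR'0
        _ = 40000 * R' * (1 / I.Hpar 1) * (1 / (j : ℝ) ^ 2) := by ring
    -- `E_1` or `E_j`
    have hE : 20000 * ((I.Hpar j * Real.log (I.Q j / I.P j)) *
        (∑ v ∈ I.blocks j, ∫ t in I.Tset (fun p => ((f p : ℝ) : ℂ)) (Real.log X ^ (1 / 15 : ℝ)) T' j,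
          ‖blockPrimePoly (fun p => ((f p : ℝ) : ℂ)) (I.P j) (I.Q j) (I.Hpar j) v t *
            blockCofactorPoly (I.bCoef f j) X (I.P j) (I.Q j) (I.Hpar j) v t‖ ^ 2)) ≤
        (K₁ - 40000) * R' * (1 / I.Hpar 1) * (1 / (j : ℝ) ^ 2) := by
      rcases eq_or_lt_of_le hj1 with h | h
      · -- `j = 1`: §8.1
        rw [← h]
        have hE1 := I.E_one_le hη hη6 f hf1 hXe hT₀0 hT'1 (by linarith : 1 ≤ I.Hpar 1)
        rw [← hR'] at hE1
        refine hE1.trans ?_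
        have hc : 2880000 * (1 + 1 / (2 * SieveIntervalSystem.alpha η 1)) ≤ K₁ - 40000 := by
          rw [hK₁]
          have : 0 ≤ 100000000 * max C₁₃ 0 := by positivity
          linarith
        have := mul_le_mul_of_nonneg_right hc (mul_nonneg hR'0 hH0'.le)
        simp only [Nat.cast_one, one_pow, div_one, mul_one]
        linarith
      · -- `j ≥ 2`: §8.2
        have hj2 : 2 ≤ j := h
        have hEj := I.E_j_le h13 hη hη6 f hf1 hX1 hT₀0 hT'1 hj2 hH1
        refine hEj.trans ?_
        have hQP : I.P 1 ≤ I.Q (j - 1) := I.P_one_le_Q_pred hη hη' hj2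
        have hP0 : 0 < I.P 1 := I.pos_P 1 le_rfl
        have hQpos : 0 < I.Q (j - 1) := I.pos_Q (by omega)
        have hfrac : (T' / X + 1) / ((j : ℝ) ^ 2 * I.Q (j - 1)) ≤ R' * (1 / I.Hpar 1) * (1 / (j : ℝ) ^ 2) := by
          have h1 : 1 / ((j : ℝ) ^ 2 * I.Q (j - 1)) ≤ 1 / (j : ℝ) ^ 2 * (1 / I.Hpar 1) := by
            calc 1 / ((j : ℝ) ^ 2 * I.Q (j - 1)) ≤ 1 / ((j : ℝ) ^ 2 * I.P 1) :=
                  one_div_le_one_div_of_le (by positivity) (mul_le_mul_of_nonneg_left hQP hjsq.le)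
              _ = 1 / (j : ℝ) ^ 2 * (1 / I.P 1) := by rw [one_div_mul_one_div]
              _ ≤ 1 / (j : ℝ) ^ 2 * (1 / I.Hpar 1) :=
                  mul_le_mul_of_nonneg_left (I.inv_P_one_le hη hη6) hjsq'.le
          have h0 : 0 ≤ T' / X + 1 := by positivity
          calc (T' / X + 1) / ((j : ℝ) ^ 2 * I.Q (j - 1)) = (T' / X + 1) * (1 / ((j : ℝ) ^ 2 * I.Q (j - 1))) := by
                rw [mul_one_div]
            _ ≤ R' * (1 / (j : ℝ) ^ 2 * (1 / I.Hpar 1)) := mul_le_mul hTXR' h1 (by positivity) hR'0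
            _ = R' * (1 / I.Hpar 1) * (1 / (j : ℝ) ^ 2) := by ring
        have hc : 100000000 * max C₁₃ 0 ≤ K₁ - 40000 := by
          rw [hK₁]
          have : 0 ≤ 2880000 * (1 + 1 / (2 * SieveIntervalSystem.alpha η 1)) := by positivity
          linarith
        calc 100000000 * max C₁₃ 0 * (T' / X + 1) / ((j : ℝ) ^ 2 * I.Q (j - 1))
            = 100000000 * max C₁₃ 0 * ((T' / X + 1) / ((j : ℝ) ^ 2 * I.Q (j - 1))) := by ring
          _ ≤ (K₁ - 40000) * (R' * (1 / I.Hpar 1) * (1 / (j : ℝ) ^ 2)) :=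
              mul_le_mul hc hfrac (by positivity) (by linarith [le_max_right C₁₃ 0])
          _ = (K₁ - 40000) * R' * (1 / I.Hpar 1) * (1 / (j : ℝ) ^ 2) := by ring
    rw [mul_add]
    linarith
  have hsumT : (∑ j ∈ Icc 1 I.J, 20000 * ((I.Hpar j * Real.log (I.Q j / I.P j)) *
          (∑ v ∈ I.blocks j, ∫ t in I.Tset (fun p => ((f p : ℝ) : ℂ)) (Real.log X ^ (1 / 15 : ℝ)) T' j,
            ‖blockPrimePoly (fun p => ((f p : ℝ) : ℂ)) (I.P j) (I.Q j) (I.Hpar j) v t *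
              blockCofactorPoly (I.bCoef f j) X (I.P j) (I.Q j) (I.Hpar j) v t‖ ^ 2)
        + (T' + X) / X * (1 / I.Hpar j + 1 / I.P j))) ≤ 2 * K₁ * R' * (1 / I.Hpar 1) := by
    calc _ ≤ ∑ j ∈ Icc 1 I.J, K₁ * R' * (1 / I.Hpar 1) * (1 / (j : ℝ) ^ 2) := sum_le_sum hj_bound
      _ = K₁ * R' * (1 / I.Hpar 1) * ∑ j ∈ Icc 1 I.J, 1 / (j : ℝ) ^ 2 := by rw [mul_sum]
      _ ≤ K₁ * R' * (1 / I.Hpar 1) * 2 :=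
          mul_le_mul_of_nonneg_left (SieveIntervalSystem.sum_Icc_inv_sq_le_two _) (by positivity)
      _ = 2 * K₁ * R' * (1 / I.Hpar 1) := by ring
  -- (iv) the `𝒰`-term
  have hU := I.integral_Uset_bound hC₃ h3' hC₈ h8 hC₉ h9 hC₁₁ h11' hC.le hBT hK0.le hK hη hη6 f hf hf1
    hXe c2 c3 c4 c5 c6 c7 hXT' hT'X hH1
  have hJ := I.four_pow_J_le hη hη6 hL1
  have hneg50 : Real.log X ^ (-(1 / 50) : ℝ) = 1 / Real.log X ^ (1 / 50 : ℝ) := by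
    rw [Real.rpow_neg hL0.le, inv_eq_one_div]
  have hneg40 : (4 : ℝ) ^ I.J * Real.log X ^ (-(1 / 40) : ℝ) ≤
      Real.exp (2 * Real.exp 72) * (1 / Real.log X ^ (1 / 50 : ℝ)) := by
    have h1 : Real.log X ^ (1 / 200 : ℝ) * Real.log X ^ (-(1 / 40) : ℝ) = 1 / Real.log X ^ (1 / 50 : ℝ) := by
      rw [← Real.rpow_add hL0, ← hneg50]; norm_num
    calc (4 : ℝ) ^ I.J * Real.log X ^ (-(1 / 40) : ℝ)
        ≤ (Real.exp (2 * Real.exp 72) * Real.log X ^ (1 / 200 : ℝ)) * Real.log X ^ (-(1 / 40) : ℝ) :=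
          mul_le_mul_of_nonneg_right hJ (Real.rpow_nonneg hL0.le _)
      _ = Real.exp (2 * Real.exp 72) * (1 / Real.log X ^ (1 / 50 : ℝ)) := by rw [mul_assoc, h1]
  have hUfin : ∫ t in I.Uset (fun p => ((f p : ℝ) : ℂ)) (Real.log X ^ (1 / 15 : ℝ)) T',
        ‖∑ n ∈ (Icc ⌈X⌉₊ ⌊2 * X⌋₊).filter I.Mem, (f n : ℂ) * (n : ℂ) ^ (-(1 + (t : ℂ) * Complex.I))‖ ^ 2 ≤
      K₂ * R' * (1 / Real.log X ^ (1 / 50 : ℝ)) := by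
    refine hU.trans ?_
    rw [hneg50]
    have hA0 : 0 ≤ 20000 * (2 + K * (2 * Real.exp 6 + 1)) := by positivity
    have hB0 : 0 ≤ 160000 * C₉ * (4 + 4 ^ 20 * C₈) := by positivity
    have hD0 : 0 ≤ 17280000 * C₃ ^ 2 * C₁₁ * C * (1 + C₈) := by positivity
    have hi0 : 0 ≤ 1 / Real.log X ^ (1 / 50 : ℝ) := by positivity
    have t1 : (T' / X + 1) * (20000 * (2 + K * (2 * Real.exp 6 + 1))) * (1 / Real.log X ^ (1 / 50 : ℝ)) ≤
        R' * (20000 * (2 + K * (2 * Real.exp 6 + 1))) * (1 / Real.log X ^ (1 / 50 : ℝ)) :=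
      mul_le_mul_of_nonneg_right (mul_le_mul_of_nonneg_right hTXR' hA0) hi0
    have t2 : 160000 * C₉ * (4 + 4 ^ 20 * C₈) * (1 / Real.log X ^ (1 / 50 : ℝ)) ≤
        R' * (160000 * C₉ * (4 + 4 ^ 20 * C₈)) * (1 / Real.log X ^ (1 / 50 : ℝ)) := by
      have := mul_le_mul_of_nonneg_right
        (le_mul_of_one_le_left hB0 hR'1 : 160000 * C₉ * (4 + 4 ^ 20 * C₈) ≤ R' * (160000 * C₉ * (4 + 4 ^ 20 * C₈))) hi0
      exact this
    have t3 : 17280000 * C₃ ^ 2 * C₁₁ * C * (1 + C₈) * 4 ^ I.J * Real.log X ^ (-(1 / 40) : ℝ) ≤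
        R' * (17280000 * C₃ ^ 2 * C₁₁ * C * (1 + C₈) * Real.exp (2 * Real.exp 72)) *
          (1 / Real.log X ^ (1 / 50 : ℝ)) := by
      calc 17280000 * C₃ ^ 2 * C₁₁ * C * (1 + C₈) * 4 ^ I.J * Real.log X ^ (-(1 / 40) : ℝ)
          = 17280000 * C₃ ^ 2 * C₁₁ * C * (1 + C₈) * ((4 : ℝ) ^ I.J * Real.log X ^ (-(1 / 40) : ℝ)) := by ring
        _ ≤ 17280000 * C₃ ^ 2 * C₁₁ * C * (1 + C₈) *
              (Real.exp (2 * Real.exp 72) * (1 / Real.log X ^ (1 / 50 : ℝ))) :=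
            mul_le_mul_of_nonneg_left hneg40 hD0
        _ = 1 * ((17280000 * C₃ ^ 2 * C₁₁ * C * (1 + C₈) * Real.exp (2 * Real.exp 72)) *
              (1 / Real.log X ^ (1 / 50 : ℝ))) := by ring
        _ ≤ R' * ((17280000 * C₃ ^ 2 * C₁₁ * C * (1 + C₈) * Real.exp (2 * Real.exp 72)) *
              (1 / Real.log X ^ (1 / 50 : ℝ))) :=
            mul_le_mul_of_nonneg_right hR'1 (by positivity)
        _ = _ := by ring
    rw [hK₂]
    linarith [t1, t2, t3]
  -- (v) conclusion
  have hfin : 2 * K₁ * R' * (1 / I.Hpar 1) + K₂ * R' * (1 / Real.log X ^ (1 / 50 : ℝ)) ≤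
      (164 + 4 * K₁ + 2 * K₂) * (T * I.Q 1 / X + 1) * (1 / I.Hpar 1 + 1 / Real.log X ^ (1 / 50 : ℝ)) := by
    have hi0 : 0 ≤ 1 / Real.log X ^ (1 / 50 : ℝ) := by positivity
    have hR0 : 0 ≤ T * I.Q 1 / X + 1 := by linarith
    have a1 : 2 * K₁ * R' * (1 / I.Hpar 1) ≤ 2 * K₁ * (2 * (T * I.Q 1 / X + 1)) * (1 / I.Hpar 1) :=
      mul_le_mul_of_nonneg_right (mul_le_mul_of_nonneg_left hR'R (by linarith)) hH0'.le
    have a2 : K₂ * R' * (1 / Real.log X ^ (1 / 50 : ℝ)) ≤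
        K₂ * (2 * (T * I.Q 1 / X + 1)) * (1 / Real.log X ^ (1 / 50 : ℝ)) :=
      mul_le_mul_of_nonneg_right (mul_le_mul_of_nonneg_left hR'R hK₂0) hi0
    linarith [mul_nonneg hR0 hi0, mul_nonneg hR0 hH0'.le, mul_nonneg (mul_nonneg hK₁0 hR0) hi0,
      mul_nonneg (mul_nonneg hK₂0 hR0) hH0'.le]
  calc ∫ t in Real.log X ^ (1 / 15 : ℝ)..T,
        ‖∑ n ∈ (Icc ⌈X⌉₊ ⌊2 * X⌋₊).filter I.Mem, (f n : ℂ) * (n : ℂ) ^ (-(1 + (t : ℂ) * Complex.I))‖ ^ 2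
      ≤ ∫ t in Real.log X ^ (1 / 15 : ℝ)..T',
        ‖∑ n ∈ (Icc ⌈X⌉₊ ⌊2 * X⌋₊).filter I.Mem, (f n : ℂ) * (n : ℂ) ^ (-(1 + (t : ℂ) * Complex.I))‖ ^ 2 :=
        hmono
    _ ≤ _ := hpart
    _ ≤ 2 * K₁ * R' * (1 / I.Hpar 1) + K₂ * R' * (1 / Real.log X ^ (1 / 50 : ℝ)) := add_le_add hsumT hUfin
    _ ≤ _ := hfin

/-- **Proposition 1 from Granville–Soundararajan's Theorem 1, Ford's bound for `ζ` and Lemma 11**: Lemma 3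
is discharged from the first two by `MatomakiRadziwill2016_lemma3_of_GS_ford` (`…Lemma3.lean`), so these
three named facts are exactly what the discharge `MatomakiRadziwill2016_prop1_holds` still requires.
[cite: MatomakiRadziwillAnnals2016, Proposition 1] -/
theorem MatomakiRadziwill2016_prop1_of_GS_ford_lemma11
    (hGS : Literature.NumberTheory.LFunctions.GranvilleSoundararajan.GranvilleSoundararajan2003_theorem1)
    (hF : Literature.NumberTheory.LFunctions.zeta_bound_ford) (h11 : MatomakiRadziwill2016_lemma11) :
    MatomakiRadziwill2016_prop1 :=
  MatomakiRadziwill2016_prop1_of_lemma3_lemma11 (MatomakiRadziwill2016_lemma3_of_GS_ford hGS hF) h11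

/-! ### Downstream: Theorem 3, Theorem 1 and parity.S38 from Lemmas 3, 4, 11 -/

/-- **Theorem 3 of Matomäki–Radziwiłł from its Lemmas 3, 4 and 11** (everything else — Lemmas 5, 6, 7, 8,
9, 12, 13, 14, Proposition 1's assembly and §9's deduction of Theorem 3 — is proved in the tree).
[cite: MatomakiRadziwillAnnals2016, Theorem 3] -/
theorem MatomakiRadziwill2016_theorem3_of_lemma3_lemma4_lemma11 (h3 : MatomakiRadziwill2016_lemma3)
    (h4 : MatomakiRadziwill2016_lemma4) (h11 : MatomakiRadziwill2016_lemma11) :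
    MatomakiRadziwill2016_theorem3 :=
  MatomakiRadziwill2016_theorem3_of_prop1_real MatomakiRadziwill2016_lemma14_real_holds h4
    (MatomakiRadziwill2016_prop1_of_lemma3_lemma11 h3 h11)

/-- **Theorem 1 of Matomäki–Radziwiłł from its Lemmas 3, 4 and 11.** [cite: MatomakiRadziwillAnnals2016, Theorem 1] -/
theorem MatomakiRadziwill2016_theorem1_of_lemma3_lemma4_lemma11 (h3 : MatomakiRadziwill2016_lemma3)
    (h4 : MatomakiRadziwill2016_lemma4) (h11 : MatomakiRadziwill2016_lemma11) :
    MatomakiRadziwill2016_theorem1 :=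
  MatomakiRadziwill2016_theorem1_of_theorem3 (MatomakiRadziwill2016_theorem3_of_lemma3_lemma4_lemma11 h3 h4 h11)

/-- **parity.S38 (`matomaki_radziwill`) from Lemmas 3, 4 and 11 of Matomäki–Radziwiłł.**
[cite: MatomakiRadziwillAnnals2016, Theorem 1] -/
theorem matomaki_radziwill_of_lemma3_lemma4_lemma11 (h3 : MatomakiRadziwill2016_lemma3)
    (h4 : MatomakiRadziwill2016_lemma4) (h11 : MatomakiRadziwill2016_lemma11) : matomaki_radziwill :=
  matomaki_radziwill_of_theorem1 (MatomakiRadziwill2016_theorem1_of_lemma3_lemma4_lemma11 h3 h4 h11)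

/-- **Deprecated — vacuous** (verdict clean-up 2026-08-15): the hypothesis `h4`,
`GranvilleSoundararajan2003_theorem4_sqrtRange` (GS03 Theorem 4 asserted for EVERY maximiser of the window), is
refuted in tree (`GranvilleSoundararajan2003_theorem4_sqrtRange_false`) and `@[deprecated]`; parity.S38 from
Lemma 4, Ford's bound and a zero-free region is `matomaki_radziwill_of_lemma4_ford_khale`
(`MatomakiRadziwillTheorem1Khale.lean`), and with Lemma 4 proved from the corrected central form of Theorem 4,
`matomaki_radziwill_of_khale` / `matomaki_radziwill_of_vk` (`MatomakiRadziwillTheorem3VK.lean`).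
Formerly: **parity.S38 (`matomaki_radziwill`) from the pretentious inputs**: Granville–Soundararajan 2003
(Theorem 1, Lemma 2.3, Theorem 3, Theorem 4 on `[√x, x]`, Corollary 3, Lemma 7.1 — the inputs of Lemma 4, of
which Theorem 1 also serves Lemma 3), Ford's bound for `ζ` (behind Lemma 2) and Lemma 11 of the paper (the
Halász inequality for primes, resting on the Vinogradov–Korobov zero-free region).
[cite: MatomakiRadziwillAnnals2016, Theorem 1] -/
@[deprecated "vacuous: the hypothesis GranvilleSoundararajan2003_theorem4_sqrtRange is refuted \
  (GranvilleSoundararajan2003_theorem4_sqrtRange_false); use \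
  Literature.NumberTheory.Sieve.matomaki_radziwill_of_lemma4_ford_khale (MatomakiRadziwillTheorem1Khale.lean) \
  or matomaki_radziwill_of_khale / matomaki_radziwill_of_vk (MatomakiRadziwillTheorem3VK.lean)"
  (since := "2026-08-15")]
theorem matomaki_radziwill_of_GS_ford_lemma11
    (h1 : Literature.NumberTheory.LFunctions.GranvilleSoundararajan.GranvilleSoundararajan2003_theorem1)
    (h23 : Literature.NumberTheory.LFunctions.GranvilleSoundararajan.GranvilleSoundararajan2003_lemma23)
    (h3 : Literature.NumberTheory.LFunctions.GranvilleSoundararajan.GranvilleSoundararajan2003_theorem3)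
    (h4 : Literature.NumberTheory.LFunctions.GranvilleSoundararajan.GranvilleSoundararajan2003_theorem4_sqrtRange)
    (hc3 : Literature.NumberTheory.LFunctions.GranvilleSoundararajan.GranvilleSoundararajan2003_corollary3)
    (h71 : Literature.NumberTheory.LFunctions.GranvilleSoundararajan.GranvilleSoundararajan2003_lemma71)
    (hF : Literature.NumberTheory.LFunctions.zeta_bound_ford) (h11 : MatomakiRadziwill2016_lemma11) :
    matomaki_radziwill :=
  matomaki_radziwill_of_lemma3_lemma4_lemma11 (MatomakiRadziwill2016_lemma3_of_GS_ford h1 hF)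
    (MatomakiRadziwill2016_lemma4_of_GS h1 h23 h3 h4 hc3 h71) h11

/-! ### With Granville–Soundararajan's Theorem 1, Lemma 2.3 and Lemma 7.1 discharged -/

/-- **Proposition 1 from Ford's bound for `ζ` and Lemma 11 only**: Granville–Soundararajan's Theorem 1 is
proved in the tree (`GranvilleSoundararajan2003_theorem1_holds`), so of the inputs of
`MatomakiRadziwill2016_prop1_of_GS_ford_lemma11` only `zeta_bound_ford` (behind Lemma 2) and
`MatomakiRadziwill2016_lemma11` remain named facts. [cite: MatomakiRadziwillAnnals2016, Proposition 1] -/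
theorem MatomakiRadziwill2016_prop1_of_ford_lemma11 (hF : Literature.NumberTheory.LFunctions.zeta_bound_ford)
    (h11 : MatomakiRadziwill2016_lemma11) : MatomakiRadziwill2016_prop1 :=
  MatomakiRadziwill2016_prop1_of_GS_ford_lemma11
    Literature.NumberTheory.LFunctions.GranvilleSoundararajan.GranvilleSoundararajan2003_theorem1_holds hF h11

/-- **Deprecated — vacuous** (verdict clean-up 2026-08-15): the hypothesis `h4`,
`GranvilleSoundararajan2003_theorem4_sqrtRange`, is refuted in tree
(`GranvilleSoundararajan2003_theorem4_sqrtRange_false`) and `@[deprecated]`; see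
`matomaki_radziwill_of_GS_ford_lemma11` for the replacements (`matomaki_radziwill_of_lemma4_ford_khale`,
`matomaki_radziwill_of_khale`, `matomaki_radziwill_of_vk`).
Formerly: **parity.S38 (`matomaki_radziwill`) from the five named facts then open on its cone**: Granville–
Soundararajan's Theorem 3, Theorem 4 (on `[√x, x]`) and Corollary 3 (inputs of Lemma 4; their Theorem 1,
Lemma 2.3 and Lemma 7.1 are discharged in the tree), Ford's bound for `ζ` (behind Lemma 2) and Lemma 11 of
the paper. [cite: MatomakiRadziwillAnnals2016, Theorem 1] -/
@[deprecated "vacuous: the hypothesis GranvilleSoundararajan2003_theorem4_sqrtRange is refuted \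
  (GranvilleSoundararajan2003_theorem4_sqrtRange_false); use \
  Literature.NumberTheory.Sieve.matomaki_radziwill_of_lemma4_ford_khale (MatomakiRadziwillTheorem1Khale.lean) \
  or matomaki_radziwill_of_khale / matomaki_radziwill_of_vk (MatomakiRadziwillTheorem3VK.lean)"
  (since := "2026-08-15")]
theorem matomaki_radziwill_of_GS_theorem3_theorem4_corollary3_ford_lemma11
    (h3 : Literature.NumberTheory.LFunctions.GranvilleSoundararajan.GranvilleSoundararajan2003_theorem3)
    (h4 : Literature.NumberTheory.LFunctions.GranvilleSoundararajan.GranvilleSoundararajan2003_theorem4_sqrtRange)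
    (hc3 : Literature.NumberTheory.LFunctions.GranvilleSoundararajan.GranvilleSoundararajan2003_corollary3)
    (hF : Literature.NumberTheory.LFunctions.zeta_bound_ford) (h11 : MatomakiRadziwill2016_lemma11) :
    matomaki_radziwill :=
  matomaki_radziwill_of_GS_ford_lemma11
    Literature.NumberTheory.LFunctions.GranvilleSoundararajan.GranvilleSoundararajan2003_theorem1_holds
    Literature.NumberTheory.LFunctions.GranvilleSoundararajan.GranvilleSoundararajan2003_lemma23_holds h3 h4 hc3
    Literature.NumberTheory.LFunctions.GranvilleSoundararajan.GranvilleSoundararajan2003_lemma71_holds hF h11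

end Literature.NumberTheory.Sieve
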